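/-
Copyright (c) 2026. All rights reserved.
Released under Apache 2.0 license as described in the file LICENSE.
-/
import Literature.Geometry.Kaehler.ComplexTorusQuaternionXSixSpecialCyclesPrimitiveClassNumbers
import HarnessLib

/-!
# Primitive special cycles on `X₆`: `Z(t) = Σ_{c² ∣ t} Z_prim(t/c²)` at the level of degrees, and Möbius inversion
# `deg Z_prim(n²t₁)_ℚ = Σ_{ab = n} μ(a)·deg Z(b²t₁)_ℚ`

Kudla–Rapoport–Yang's special `0`-cycle `Z(t)` on the Shimura curve `X₆` (`B = (−1,3)_ℚ`, maximal order `O₆`) has degree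
`deg Z(t)_ℚ = 2·Σ_{[ŷ] ∈ L(t)/O₆^×} e_y⁻¹` ((3.4.13)–(3.4.14)), and (3.4.4)–(3.4.6) write it as a sum over the quadratic orders
`O_{c²d}`, `c ∣ n` (`4t = n²d`), through which the special endomorphism acts: `H₀(t,D) = Σ_{c∣n} h(c²d)/w(c²d)`. On the
vector side the summand of conductor-index `c` is the **primitive special cycle** `Z_prim(t/c²)`: the classes of PRIMITIVE
vectors `p ∈ L_prim(m)` (`m = t/c²`) weighted by `e_p⁻¹`. This file (sequel of `…XSixSpecialCyclesPrimitiveClassNumbers`,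
which did the unweighted counts `P(m) = |L_prim(m)/O₆^×|`) treats the WEIGHTED sums
`deg Z_prim(m)_ℚ := 2·Σᶠ_{[p] ∈ L_prim(m)/O₆^×} e_p⁻¹`:

* §1 the classes `L_prim(m)/O₆^×`: `primitive_conj_equivalence`, `primitive_conj_mk_eq_iff`, `finite_primitive_classes`,
  `card_primitive_le_card_unit_classes` (`P(m) ≤ |L(m)/O₆^×|`), and the weights: **`e_p = 4, 6, 2` according as
  `m = 1`, `m = 3`, `m ∉ {1,3}`** (`card_unitStab_primitive`; `ℤ[i]^×`, `ℤ[ζ₆]^×`, `{±1}`), constant on `L_prim(m)`, so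
  **`Σᶠ_{L_prim(m)/O₆^×} e⁻¹ = P(m)/w(m)`** (`finsum_primitive_eq_card_div`), `w(1) = 4`, `w(3) = 6`, `w(m) = 2` otherwise.
* §2 **`Σᶠ_{L(t)/O₆^×} e⁻¹ = Σ_{c² ∣ t} Σᶠ_{L_prim(t/c²)/O₆^×} e⁻¹`**, i.e. **`deg Z(t)_ℚ = Σ_{c² ∣ t} deg Z_prim(t/c²)_ℚ`**
  (`degree_eq_sum_primitive_degrees`, all `t > 0`) — KRY's `Σ_{c∣n}`; for `t = n²t₁` with `t₁` squarefree a divisor sum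
  `Σ_{i ∣ n} deg Z_prim(i²t₁)_ℚ` (`finsum_unit_classes_sq_mul_eq_sum_divisors_finsum`), hence by MÖBIUS INVERSION
  **`deg Z_prim(n²t₁)_ℚ = Σ_{ab = n} μ(a)·deg Z(b²t₁)_ℚ`** (`finsum_primitive_eq_sum_moebius`, `degree_primitive_eq_sum_moebius`).
* §3 values: `deg Z_prim(1)_ℚ = 1`, `deg Z_prim(3)_ℚ = 2/3`, `deg Z_prim(25)_ℚ = deg Z_prim(75)_ℚ = 4`, `deg Z_prim(100)_ℚ = 0`,
  and the decompositions **`deg Z(25) = deg Z_prim(25) + deg Z_prim(1) = 4 + 1`**, **`deg Z(75) = deg Z_prim(75) + deg Z_prim(3)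
  = 4 + 2/3`** — the two terms `c = 1` and `c = 5` of KRY's `Σ_{c∣5}` (`h(−100)/w·… + h(−4)/w·…`), matching
  `degree_value_twentyfive = 5` and `degree_value_seventyfive = 14/3`.

## Sources

* [KRY] S. Kudla, M. Rapoport, T. Yang, *Modular Forms and Special Cycles on Shimura Curves*, Ann. of Math. Stud. 161
  (2006), §3.4 (3.4.4)–(3.4.6) («`H₀(t,D) = Σ_{c∣n} h(c²d)/w(c²d)` … the order `O_{c²d}` of conductor `c`»), (3.4.13)–(3.4.14),
  Remark 3.4.7, Prop. 3.4.6. [cite: KudlaRapoportYang2006, §3.4 (3.4.4)–(3.4.6), (3.4.13)–(3.4.14), Remark 3.4.7]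
* [Vignéras] M.-F. Vignéras, *Arithmétique des algèbres de quaternions*, LNM 800 (1980), Ch. I §4 p. 26 («la réunion
  disjointe `C(h) = ∪_B C(h,B)` quand `B` parcourt les ordres de `L`»), Ch. III §5.C Cor. 5.11–5.14 p. 82–83.
  [cite: VignerasLNM800, Ch. I §4; Ch. III §5.C Cor. 5.11–5.14]
* [Apostol] T. M. Apostol, *Introduction to Analytic Number Theory* (1976), §2.7 Thm. 2.9 (Möbius inversion).
  [cite: Apostol1976, §2.7 Thm. 2.9]

## Scope (honest)

Theorems only — no definitions, no named facts, no instances; `L_prim(m)`, its classes and `deg Z_prim` are inline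
expressions. The weights `e_p` come from `card_unitStab_content_smul_primitive` (`…DegreeStructure`); nothing here evaluates
`P(m)` beyond the table values already in the tree.
-/

set_option maxSynthPendingDepth 3

open Quaternion Function Literature.NumberTheory.QuadraticFields.Quadratic

namespace Literature.Geometry.Kaehler.ComplexTorus.QuaternionType

/-! ## §0 Helpers -/

section Helpers

/-- A pure quaternion is anti-self-conjugate. [folklore] -/
private theorem star_pureVec₄₄ (a b c : ℚ) : star (⟨0, a, b, c⟩ : ℍ[ℚ,((-1 : ℤ) : ℚ),((3 : ℤ) : ℚ)]) = -⟨0, a, b, c⟩ :=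
  QuaternionAlgebra.star_eq_neg.mpr rfl

/-- A finite sum of a constant function. [folklore] -/
private theorem finsum_eq_card_mul_of_forall_eq₄₄ {α : Type*} [Finite α] {f : α → ℚ} {a : ℚ} (h : ∀ x, f x = a) :
    ∑ᶠ x, f x = Nat.card α * a := by
  haveI := Fintype.ofFinite α
  rw [finsum_eq_sum_of_fintype, Finset.sum_congr rfl (fun x _ ↦ h x), Finset.sum_const, Finset.card_univ,
    Nat.card_eq_fintype_card, nsmul_eq_mul]

/-- Transport of `Σᶠ_{L(t)/O₆^×} e⁻¹` along an equality of norms. [folklore] -/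
private theorem finsum_unit_congr₄₄ {t₁ t₂ : ℤ} (h : t₁ = t₂) :
    ∑ᶠ q : (Quot (fun x y : {x : ℤ × ℤ × ℤ // x.1 ^ 2 - 3 * x.2.1 ^ 2 - 3 * x.2.2 ^ 2 = t₁} ↦
      ∃ v : ℍ[ℚ,((-1 : ℤ) : ℚ),((3 : ℤ) : ℚ)], (v ∈ order (-1) 3 ∨ v - ⟨1/2, 1/2, 1/2, -1/2⟩ ∈ order (-1) 3) ∧
        ((v * star v).re = 1 ∨ (v * star v).re = -1) ∧
        v * ⟨0, x.1.1, x.1.2.1, x.1.2.2⟩ = ⟨0, y.1.1, y.1.2.1, y.1.2.2⟩ * v)),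
        ((Nat.card
          {u : ℍ[ℚ,((-1 : ℤ) : ℚ),((3 : ℤ) : ℚ)] // (u ∈ order (-1) 3 ∨ u - ⟨1/2, 1/2, 1/2, -1/2⟩ ∈ order (-1) 3) ∧
            ((u * star u).re = 1 ∨ (u * star u).re = -1) ∧
            u * ⟨0, q.out.1.1, q.out.1.2.1, q.out.1.2.2⟩ = ⟨0, q.out.1.1, q.out.1.2.1, q.out.1.2.2⟩ * u} : ℚ))⁻¹ =
    ∑ᶠ q : (Quot (fun x y : {x : ℤ × ℤ × ℤ // x.1 ^ 2 - 3 * x.2.1 ^ 2 - 3 * x.2.2 ^ 2 = t₂} ↦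
      ∃ v : ℍ[ℚ,((-1 : ℤ) : ℚ),((3 : ℤ) : ℚ)], (v ∈ order (-1) 3 ∨ v - ⟨1/2, 1/2, 1/2, -1/2⟩ ∈ order (-1) 3) ∧
        ((v * star v).re = 1 ∨ (v * star v).re = -1) ∧
        v * ⟨0, x.1.1, x.1.2.1, x.1.2.2⟩ = ⟨0, y.1.1, y.1.2.1, y.1.2.2⟩ * v)),
        ((Nat.card
          {u : ℍ[ℚ,((-1 : ℤ) : ℚ),((3 : ℤ) : ℚ)] // (u ∈ order (-1) 3 ∨ u - ⟨1/2, 1/2, 1/2, -1/2⟩ ∈ order (-1) 3) ∧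
            ((u * star u).re = 1 ∨ (u * star u).re = -1) ∧
            u * ⟨0, q.out.1.1, q.out.1.2.1, q.out.1.2.2⟩ = ⟨0, q.out.1.1, q.out.1.2.1, q.out.1.2.2⟩ * u} : ℚ))⁻¹ := by
  subst h; rfl

/-- Transport of `Σᶠ_{L_prim(m)/O₆^×} e⁻¹` along an equality of norms. [folklore] -/
private theorem finsum_primitive_congr₄₄ {m₁ m₂ : ℤ} (h : m₁ = m₂) :
    ∑ᶠ q : (Quot (fun x y : {x : ℤ × ℤ × ℤ // x.1 ^ 2 - 3 * x.2.1 ^ 2 - 3 * x.2.2 ^ 2 = m₁ ∧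
      ∃ u : ℤ × ℤ × ℤ, u.1 * x.1 + u.2.1 * x.2.1 + u.2.2 * x.2.2 = 1} ↦
      ∃ v : ℍ[ℚ,((-1 : ℤ) : ℚ),((3 : ℤ) : ℚ)], (v ∈ order (-1) 3 ∨ v - ⟨1/2, 1/2, 1/2, -1/2⟩ ∈ order (-1) 3) ∧
        ((v * star v).re = 1 ∨ (v * star v).re = -1) ∧
        v * ⟨0, x.1.1, x.1.2.1, x.1.2.2⟩ = ⟨0, y.1.1, y.1.2.1, y.1.2.2⟩ * v)),
        ((Nat.card
          {u : ℍ[ℚ,((-1 : ℤ) : ℚ),((3 : ℤ) : ℚ)] // (u ∈ order (-1) 3 ∨ u - ⟨1/2, 1/2, 1/2, -1/2⟩ ∈ order (-1) 3) ∧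
            ((u * star u).re = 1 ∨ (u * star u).re = -1) ∧
            u * ⟨0, q.out.1.1, q.out.1.2.1, q.out.1.2.2⟩ = ⟨0, q.out.1.1, q.out.1.2.1, q.out.1.2.2⟩ * u} : ℚ))⁻¹ =
    ∑ᶠ q : (Quot (fun x y : {x : ℤ × ℤ × ℤ // x.1 ^ 2 - 3 * x.2.1 ^ 2 - 3 * x.2.2 ^ 2 = m₂ ∧
      ∃ u : ℤ × ℤ × ℤ, u.1 * x.1 + u.2.1 * x.2.1 + u.2.2 * x.2.2 = 1} ↦
      ∃ v : ℍ[ℚ,((-1 : ℤ) : ℚ),((3 : ℤ) : ℚ)], (v ∈ order (-1) 3 ∨ v - ⟨1/2, 1/2, 1/2, -1/2⟩ ∈ order (-1) 3) ∧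
        ((v * star v).re = 1 ∨ (v * star v).re = -1) ∧
        v * ⟨0, x.1.1, x.1.2.1, x.1.2.2⟩ = ⟨0, y.1.1, y.1.2.1, y.1.2.2⟩ * v)),
        ((Nat.card
          {u : ℍ[ℚ,((-1 : ℤ) : ℚ),((3 : ℤ) : ℚ)] // (u ∈ order (-1) 3 ∨ u - ⟨1/2, 1/2, 1/2, -1/2⟩ ∈ order (-1) 3) ∧
            ((u * star u).re = 1 ∨ (u * star u).re = -1) ∧
            u * ⟨0, q.out.1.1, q.out.1.2.1, q.out.1.2.2⟩ = ⟨0, q.out.1.1, q.out.1.2.1, q.out.1.2.2⟩ * u} : ℚ))⁻¹ := by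
  subst h; rfl

end Helpers

/-! ## §1 The classes `L_prim(m)/O₆^×` and their weights -/

section PrimitiveClasses

/-- **`O₆^×`-conjugacy is an equivalence relation on the primitive vectors of norm `m`** (the restriction of
`unit_conj_equivalence`). [cite: KudlaRapoportYang2006, §3.4 (3.4.13)] [cite: VignerasLNM800, Ch. I §4 p. 26] -/
theorem primitive_conj_equivalence (m : ℤ) :
    Equivalence (fun x y : {x : ℤ × ℤ × ℤ // x.1 ^ 2 - 3 * x.2.1 ^ 2 - 3 * x.2.2 ^ 2 = m ∧
      ∃ u : ℤ × ℤ × ℤ, u.1 * x.1 + u.2.1 * x.2.1 + u.2.2 * x.2.2 = 1} ↦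
      ∃ v : ℍ[ℚ,((-1 : ℤ) : ℚ),((3 : ℤ) : ℚ)], (v ∈ order (-1) 3 ∨ v - ⟨1/2, 1/2, 1/2, -1/2⟩ ∈ order (-1) 3) ∧
        ((v * star v).re = 1 ∨ (v * star v).re = -1) ∧
        v * ⟨0, x.1.1, x.1.2.1, x.1.2.2⟩ = ⟨0, y.1.1, y.1.2.1, y.1.2.2⟩ * v) :=
  (unit_conj_equivalence m).comap (fun x : {x : ℤ × ℤ × ℤ // x.1 ^ 2 - 3 * x.2.1 ^ 2 - 3 * x.2.2 ^ 2 = m ∧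
      ∃ u : ℤ × ℤ × ℤ, u.1 * x.1 + u.2.1 * x.2.1 + u.2.2 * x.2.2 = 1} ↦ (⟨x.1, x.2.1⟩ : {x : ℤ × ℤ × ℤ // x.1 ^ 2 - 3 * x.2.1 ^ 2 - 3 * x.2.2 ^ 2 = m}))

/-- **Two primitive vectors define the same class iff they are `O₆^×`-conjugate.** [cite: KudlaRapoportYang2006, §3.4 (3.4.13)] -/
theorem primitive_conj_mk_eq_iff (m : ℤ) (x y : {x : ℤ × ℤ × ℤ // x.1 ^ 2 - 3 * x.2.1 ^ 2 - 3 * x.2.2 ^ 2 = m ∧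
      ∃ u : ℤ × ℤ × ℤ, u.1 * x.1 + u.2.1 * x.2.1 + u.2.2 * x.2.2 = 1}) :
    Quot.mk (fun x y : {x : ℤ × ℤ × ℤ // x.1 ^ 2 - 3 * x.2.1 ^ 2 - 3 * x.2.2 ^ 2 = m ∧
      ∃ u : ℤ × ℤ × ℤ, u.1 * x.1 + u.2.1 * x.2.1 + u.2.2 * x.2.2 = 1} ↦
      ∃ v : ℍ[ℚ,((-1 : ℤ) : ℚ),((3 : ℤ) : ℚ)], (v ∈ order (-1) 3 ∨ v - ⟨1/2, 1/2, 1/2, -1/2⟩ ∈ order (-1) 3) ∧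
        ((v * star v).re = 1 ∨ (v * star v).re = -1) ∧
        v * ⟨0, x.1.1, x.1.2.1, x.1.2.2⟩ = ⟨0, y.1.1, y.1.2.1, y.1.2.2⟩ * v) x = Quot.mk _ y ↔
      ∃ v : ℍ[ℚ,((-1 : ℤ) : ℚ),((3 : ℤ) : ℚ)], (v ∈ order (-1) 3 ∨ v - ⟨1/2, 1/2, 1/2, -1/2⟩ ∈ order (-1) 3) ∧ ((v * star v).re = 1 ∨ (v * star v).re = -1) ∧ v * ⟨0, x.1.1, x.1.2.1, x.1.2.2⟩ = ⟨0, y.1.1, y.1.2.1, y.1.2.2⟩ * v := by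
  rw [Quot.eq]
  exact (primitive_conj_equivalence m).eqvGen_iff

/-- **`L_prim(m)/O₆^× ↪ L(m)/O₆^×`** (forgetting primitivity is injective on classes). [folklore] -/
private theorem incl_map₄₄ (m : ℤ) :
    ∃ Φ : (Quot (fun x y : {x : ℤ × ℤ × ℤ // x.1 ^ 2 - 3 * x.2.1 ^ 2 - 3 * x.2.2 ^ 2 = m ∧
      ∃ u : ℤ × ℤ × ℤ, u.1 * x.1 + u.2.1 * x.2.1 + u.2.2 * x.2.2 = 1} ↦
      ∃ v : ℍ[ℚ,((-1 : ℤ) : ℚ),((3 : ℤ) : ℚ)], (v ∈ order (-1) 3 ∨ v - ⟨1/2, 1/2, 1/2, -1/2⟩ ∈ order (-1) 3) ∧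
        ((v * star v).re = 1 ∨ (v * star v).re = -1) ∧
        v * ⟨0, x.1.1, x.1.2.1, x.1.2.2⟩ = ⟨0, y.1.1, y.1.2.1, y.1.2.2⟩ * v)) → (Quot (fun x y : {x : ℤ × ℤ × ℤ // x.1 ^ 2 - 3 * x.2.1 ^ 2 - 3 * x.2.2 ^ 2 = m} ↦
      ∃ v : ℍ[ℚ,((-1 : ℤ) : ℚ),((3 : ℤ) : ℚ)], (v ∈ order (-1) 3 ∨ v - ⟨1/2, 1/2, 1/2, -1/2⟩ ∈ order (-1) 3) ∧
        ((v * star v).re = 1 ∨ (v * star v).re = -1) ∧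
        v * ⟨0, x.1.1, x.1.2.1, x.1.2.2⟩ = ⟨0, y.1.1, y.1.2.1, y.1.2.2⟩ * v)), Function.Injective Φ := by
  refine ⟨Quot.map (fun x : {x : ℤ × ℤ × ℤ // x.1 ^ 2 - 3 * x.2.1 ^ 2 - 3 * x.2.2 ^ 2 = m ∧
      ∃ u : ℤ × ℤ × ℤ, u.1 * x.1 + u.2.1 * x.2.1 + u.2.2 * x.2.2 = 1} ↦ (⟨x.1, x.2.1⟩ : {x : ℤ × ℤ × ℤ // x.1 ^ 2 - 3 * x.2.1 ^ 2 - 3 * x.2.2 ^ 2 = m})) (fun _ _ h ↦ h), ?_⟩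
  intro a b
  induction a using Quot.ind with
  | _ x =>
    induction b using Quot.ind with
    | _ y =>
      intro h
      change Quot.mk (fun x y : {x : ℤ × ℤ × ℤ // x.1 ^ 2 - 3 * x.2.1 ^ 2 - 3 * x.2.2 ^ 2 = m} ↦
      ∃ v : ℍ[ℚ,((-1 : ℤ) : ℚ),((3 : ℤ) : ℚ)], (v ∈ order (-1) 3 ∨ v - ⟨1/2, 1/2, 1/2, -1/2⟩ ∈ order (-1) 3) ∧
        ((v * star v).re = 1 ∨ (v * star v).re = -1) ∧
        v * ⟨0, x.1.1, x.1.2.1, x.1.2.2⟩ = ⟨0, y.1.1, y.1.2.1, y.1.2.2⟩ * v) (⟨x.1, x.2.1⟩ : {x : ℤ × ℤ × ℤ // x.1 ^ 2 - 3 * x.2.1 ^ 2 - 3 * x.2.2 ^ 2 = m}) = Quot.mk _ (⟨y.1, y.2.1⟩ : {x : ℤ × ℤ × ℤ // x.1 ^ 2 - 3 * x.2.1 ^ 2 - 3 * x.2.2 ^ 2 = m}) at h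
      rw [unit_conj_mk_eq_iff] at h
      exact Quot.sound h

/-- **`L_prim(m)/O₆^×` is finite for `m > 0`.** [cite: KudlaRapoportYang2006, §3.4 Prop. 3.4.5] -/
theorem finite_primitive_classes {m : ℤ} (hm : 0 < m) :
    Finite (Quot (fun x y : {x : ℤ × ℤ × ℤ // x.1 ^ 2 - 3 * x.2.1 ^ 2 - 3 * x.2.2 ^ 2 = m ∧
      ∃ u : ℤ × ℤ × ℤ, u.1 * x.1 + u.2.1 * x.2.1 + u.2.2 * x.2.2 = 1} ↦
      ∃ v : ℍ[ℚ,((-1 : ℤ) : ℚ),((3 : ℤ) : ℚ)], (v ∈ order (-1) 3 ∨ v - ⟨1/2, 1/2, 1/2, -1/2⟩ ∈ order (-1) 3) ∧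
        ((v * star v).re = 1 ∨ (v * star v).re = -1) ∧
        v * ⟨0, x.1.1, x.1.2.1, x.1.2.2⟩ = ⟨0, y.1.1, y.1.2.1, y.1.2.2⟩ * v)) := by
  haveI := finite_unit_classes hm
  obtain ⟨Φ, hΦ⟩ := incl_map₄₄ m
  exact Finite.of_injective Φ hΦ

/-- **`P(m) = |L_prim(m)/O₆^×| ≤ |L(m)/O₆^×|`** (`m > 0`). [cite: KudlaRapoportYang2006, §3.4 (3.4.6)] -/
theorem card_primitive_le_card_unit_classes {m : ℤ} (hm : 0 < m) :
    Nat.card (Quot (fun x y : {x : ℤ × ℤ × ℤ // x.1 ^ 2 - 3 * x.2.1 ^ 2 - 3 * x.2.2 ^ 2 = m ∧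
      ∃ u : ℤ × ℤ × ℤ, u.1 * x.1 + u.2.1 * x.2.1 + u.2.2 * x.2.2 = 1} ↦
      ∃ v : ℍ[ℚ,((-1 : ℤ) : ℚ),((3 : ℤ) : ℚ)], (v ∈ order (-1) 3 ∨ v - ⟨1/2, 1/2, 1/2, -1/2⟩ ∈ order (-1) 3) ∧
        ((v * star v).re = 1 ∨ (v * star v).re = -1) ∧
        v * ⟨0, x.1.1, x.1.2.1, x.1.2.2⟩ = ⟨0, y.1.1, y.1.2.1, y.1.2.2⟩ * v)) ≤
    Nat.card (Quot (fun x y : {x : ℤ × ℤ × ℤ // x.1 ^ 2 - 3 * x.2.1 ^ 2 - 3 * x.2.2 ^ 2 = m} ↦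
      ∃ v : ℍ[ℚ,((-1 : ℤ) : ℚ),((3 : ℤ) : ℚ)], (v ∈ order (-1) 3 ∨ v - ⟨1/2, 1/2, 1/2, -1/2⟩ ∈ order (-1) 3) ∧
        ((v * star v).re = 1 ∨ (v * star v).re = -1) ∧
        v * ⟨0, x.1.1, x.1.2.1, x.1.2.2⟩ = ⟨0, y.1.1, y.1.2.1, y.1.2.2⟩ * v)) := by
  haveI := finite_unit_classes hm
  obtain ⟨Φ, hΦ⟩ := incl_map₄₄ m
  exact Nat.card_le_card_of_injective Φ hΦ

/-- **The weight is a class invariant on `L_prim(m)/O₆^×`**: `e` of the chosen representative of `[p]` equals `e_p`.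
[cite: KudlaRapoportYang2006, §3.4 (3.4.13)–(3.4.14)] -/
theorem card_unitStab_primitive_mk_out (m : ℤ) (x : {x : ℤ × ℤ × ℤ // x.1 ^ 2 - 3 * x.2.1 ^ 2 - 3 * x.2.2 ^ 2 = m ∧
      ∃ u : ℤ × ℤ × ℤ, u.1 * x.1 + u.2.1 * x.2.1 + u.2.2 * x.2.2 = 1}) :
    Nat.card {u : ℍ[ℚ,((-1 : ℤ) : ℚ),((3 : ℤ) : ℚ)] // (u ∈ order (-1) 3 ∨ u - ⟨1/2, 1/2, 1/2, -1/2⟩ ∈ order (-1) 3) ∧ ((u * star u).re = 1 ∨ (u * star u).re = -1) ∧ u * (⟨0, ((Quot.mk (fun x y : {x : ℤ × ℤ × ℤ // x.1 ^ 2 - 3 * x.2.1 ^ 2 - 3 * x.2.2 ^ 2 = m ∧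
      ∃ u : ℤ × ℤ × ℤ, u.1 * x.1 + u.2.1 * x.2.1 + u.2.2 * x.2.2 = 1} ↦
      ∃ v : ℍ[ℚ,((-1 : ℤ) : ℚ),((3 : ℤ) : ℚ)], (v ∈ order (-1) 3 ∨ v - ⟨1/2, 1/2, 1/2, -1/2⟩ ∈ order (-1) 3) ∧
        ((v * star v).re = 1 ∨ (v * star v).re = -1) ∧
        v * ⟨0, x.1.1, x.1.2.1, x.1.2.2⟩ = ⟨0, y.1.1, y.1.2.1, y.1.2.2⟩ * v) x).out).1.1, ((Quot.mk (fun x y : {x : ℤ × ℤ × ℤ // x.1 ^ 2 - 3 * x.2.1 ^ 2 - 3 * x.2.2 ^ 2 = m ∧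
      ∃ u : ℤ × ℤ × ℤ, u.1 * x.1 + u.2.1 * x.2.1 + u.2.2 * x.2.2 = 1} ↦
      ∃ v : ℍ[ℚ,((-1 : ℤ) : ℚ),((3 : ℤ) : ℚ)], (v ∈ order (-1) 3 ∨ v - ⟨1/2, 1/2, 1/2, -1/2⟩ ∈ order (-1) 3) ∧
        ((v * star v).re = 1 ∨ (v * star v).re = -1) ∧
        v * ⟨0, x.1.1, x.1.2.1, x.1.2.2⟩ = ⟨0, y.1.1, y.1.2.1, y.1.2.2⟩ * v) x).out).1.2.1, ((Quot.mk (fun x y : {x : ℤ × ℤ × ℤ // x.1 ^ 2 - 3 * x.2.1 ^ 2 - 3 * x.2.2 ^ 2 = m ∧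
      ∃ u : ℤ × ℤ × ℤ, u.1 * x.1 + u.2.1 * x.2.1 + u.2.2 * x.2.2 = 1} ↦
      ∃ v : ℍ[ℚ,((-1 : ℤ) : ℚ),((3 : ℤ) : ℚ)], (v ∈ order (-1) 3 ∨ v - ⟨1/2, 1/2, 1/2, -1/2⟩ ∈ order (-1) 3) ∧
        ((v * star v).re = 1 ∨ (v * star v).re = -1) ∧
        v * ⟨0, x.1.1, x.1.2.1, x.1.2.2⟩ = ⟨0, y.1.1, y.1.2.1, y.1.2.2⟩ * v) x).out).1.2.2⟩ : ℍ[ℚ,((-1 : ℤ) : ℚ),((3 : ℤ) : ℚ)]) = (⟨0, ((Quot.mk (fun x y : {x : ℤ × ℤ × ℤ // x.1 ^ 2 - 3 * x.2.1 ^ 2 - 3 * x.2.2 ^ 2 = m ∧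
      ∃ u : ℤ × ℤ × ℤ, u.1 * x.1 + u.2.1 * x.2.1 + u.2.2 * x.2.2 = 1} ↦
      ∃ v : ℍ[ℚ,((-1 : ℤ) : ℚ),((3 : ℤ) : ℚ)], (v ∈ order (-1) 3 ∨ v - ⟨1/2, 1/2, 1/2, -1/2⟩ ∈ order (-1) 3) ∧
        ((v * star v).re = 1 ∨ (v * star v).re = -1) ∧
        v * ⟨0, x.1.1, x.1.2.1, x.1.2.2⟩ = ⟨0, y.1.1, y.1.2.1, y.1.2.2⟩ * v) x).out).1.1, ((Quot.mk (fun x y : {x : ℤ × ℤ × ℤ // x.1 ^ 2 - 3 * x.2.1 ^ 2 - 3 * x.2.2 ^ 2 = m ∧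
      ∃ u : ℤ × ℤ × ℤ, u.1 * x.1 + u.2.1 * x.2.1 + u.2.2 * x.2.2 = 1} ↦
      ∃ v : ℍ[ℚ,((-1 : ℤ) : ℚ),((3 : ℤ) : ℚ)], (v ∈ order (-1) 3 ∨ v - ⟨1/2, 1/2, 1/2, -1/2⟩ ∈ order (-1) 3) ∧
        ((v * star v).re = 1 ∨ (v * star v).re = -1) ∧
        v * ⟨0, x.1.1, x.1.2.1, x.1.2.2⟩ = ⟨0, y.1.1, y.1.2.1, y.1.2.2⟩ * v) x).out).1.2.1, ((Quot.mk (fun x y : {x : ℤ × ℤ × ℤ // x.1 ^ 2 - 3 * x.2.1 ^ 2 - 3 * x.2.2 ^ 2 = m ∧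
      ∃ u : ℤ × ℤ × ℤ, u.1 * x.1 + u.2.1 * x.2.1 + u.2.2 * x.2.2 = 1} ↦
      ∃ v : ℍ[ℚ,((-1 : ℤ) : ℚ),((3 : ℤ) : ℚ)], (v ∈ order (-1) 3 ∨ v - ⟨1/2, 1/2, 1/2, -1/2⟩ ∈ order (-1) 3) ∧
        ((v * star v).re = 1 ∨ (v * star v).re = -1) ∧
        v * ⟨0, x.1.1, x.1.2.1, x.1.2.2⟩ = ⟨0, y.1.1, y.1.2.1, y.1.2.2⟩ * v) x).out).1.2.2⟩ : ℍ[ℚ,((-1 : ℤ) : ℚ),((3 : ℤ) : ℚ)]) * u} =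
    Nat.card {u : ℍ[ℚ,((-1 : ℤ) : ℚ),((3 : ℤ) : ℚ)] // (u ∈ order (-1) 3 ∨ u - ⟨1/2, 1/2, 1/2, -1/2⟩ ∈ order (-1) 3) ∧ ((u * star u).re = 1 ∨ (u * star u).re = -1) ∧ u * (⟨0, x.1.1, x.1.2.1, x.1.2.2⟩ : ℍ[ℚ,((-1 : ℤ) : ℚ),((3 : ℤ) : ℚ)]) = (⟨0, x.1.1, x.1.2.1, x.1.2.2⟩ : ℍ[ℚ,((-1 : ℤ) : ℚ),((3 : ℤ) : ℚ)]) * u} := by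
  have h := Quot.out_eq (Quot.mk (fun x y : {x : ℤ × ℤ × ℤ // x.1 ^ 2 - 3 * x.2.1 ^ 2 - 3 * x.2.2 ^ 2 = m ∧
      ∃ u : ℤ × ℤ × ℤ, u.1 * x.1 + u.2.1 * x.2.1 + u.2.2 * x.2.2 = 1} ↦
      ∃ v : ℍ[ℚ,((-1 : ℤ) : ℚ),((3 : ℤ) : ℚ)], (v ∈ order (-1) 3 ∨ v - ⟨1/2, 1/2, 1/2, -1/2⟩ ∈ order (-1) 3) ∧
        ((v * star v).re = 1 ∨ (v * star v).re = -1) ∧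
        v * ⟨0, x.1.1, x.1.2.1, x.1.2.2⟩ = ⟨0, y.1.1, y.1.2.1, y.1.2.2⟩ * v) x)
  rw [primitive_conj_mk_eq_iff] at h
  obtain ⟨v, hv, hn, hc⟩ := h
  exact card_unitStab_eq_of_conj (star_pureVec₄₄ _ _ _) (star_pureVec₄₄ _ _ _) hv hn hc

/-- **`e_p = |Γ_p ∩ O₆^×| = 4, 6, 2` for a PRIMITIVE `p` of norm `m = 1`, `m = 3`, `m ∉ {1, 3}`** (`ℤ[i]^×`, `ℤ[ζ₆]^×`,
`{±1}`: the unit groups of the optimally embedded orders `ℤ[i]`, `ℤ[(1+√−3)/2]`, and of every other imaginary quadratic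
order). [cite: KudlaRapoportYang2006, §3.4 (3.4.6) («`w(c²d)`») and (3.4.14)] [cite: VignerasLNM800, Ch. III §5.C Cor. 5.12] -/
theorem card_unitStab_primitive {m : ℤ} (hm : 0 < m) {x : ℤ × ℤ × ℤ} (hQ : (x.1 ^ 2 - 3 * x.2.1 ^ 2 - 3 * x.2.2 ^ 2) = m)
    (hx : ∃ u : ℤ × ℤ × ℤ, u.1 * x.1 + u.2.1 * x.2.1 + u.2.2 * x.2.2 = 1) :
    (Nat.card {u : ℍ[ℚ,((-1 : ℤ) : ℚ),((3 : ℤ) : ℚ)] // (u ∈ order (-1) 3 ∨ u - ⟨1/2, 1/2, 1/2, -1/2⟩ ∈ order (-1) 3) ∧ ((u * star u).re = 1 ∨ (u * star u).re = -1) ∧ u * (⟨0, x.1, x.2.1, x.2.2⟩ : ℍ[ℚ,((-1 : ℤ) : ℚ),((3 : ℤ) : ℚ)]) = (⟨0, x.1, x.2.1, x.2.2⟩ : ℍ[ℚ,((-1 : ℤ) : ℚ),((3 : ℤ) : ℚ)]) * u} : ℚ) = (if m = 1 then (4 : ℚ) else if m = 3 then 6 else 2) := by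
  have h := card_unitStab_content_smul_primitive (t := m) (c := 1) hm one_pos (by rw [hQ]; norm_num) hx
  simp only [Nat.cast_one, one_smul, one_pow, one_mul] at h
  rw [h]
  by_cases h1 : m = 1
  · subst h1; norm_num
  · by_cases h3 : m = 3
    · subst h3; norm_num
    · rw [if_neg (Ne.symm h1), if_neg (Ne.symm h3), if_neg h1, if_neg h3]

/-- **`Σᶠ_{[p] ∈ L_prim(m)/O₆^×} e_p⁻¹ = P(m)/w(m)`** (`m > 0`; `w(1) = 4`, `w(3) = 6`, `w(m) = 2` otherwise): half the degree of
the primitive special cycle `Z_prim(m)` is the primitive class number over the common weight — KRY's term `h(c²d)/w(c²d)`.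
[cite: KudlaRapoportYang2006, §3.4 (3.4.6) and (3.4.14)] [cite: VignerasLNM800, Ch. III §5.C Cor. 5.12–5.14] -/
theorem finsum_primitive_eq_card_div {m : ℤ} (hm : 0 < m) :
    ∑ᶠ q : (Quot (fun x y : {x : ℤ × ℤ × ℤ // x.1 ^ 2 - 3 * x.2.1 ^ 2 - 3 * x.2.2 ^ 2 = m ∧
      ∃ u : ℤ × ℤ × ℤ, u.1 * x.1 + u.2.1 * x.2.1 + u.2.2 * x.2.2 = 1} ↦
      ∃ v : ℍ[ℚ,((-1 : ℤ) : ℚ),((3 : ℤ) : ℚ)], (v ∈ order (-1) 3 ∨ v - ⟨1/2, 1/2, 1/2, -1/2⟩ ∈ order (-1) 3) ∧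
        ((v * star v).re = 1 ∨ (v * star v).re = -1) ∧
        v * ⟨0, x.1.1, x.1.2.1, x.1.2.2⟩ = ⟨0, y.1.1, y.1.2.1, y.1.2.2⟩ * v)),
        ((Nat.card
          {u : ℍ[ℚ,((-1 : ℤ) : ℚ),((3 : ℤ) : ℚ)] // (u ∈ order (-1) 3 ∨ u - ⟨1/2, 1/2, 1/2, -1/2⟩ ∈ order (-1) 3) ∧
            ((u * star u).re = 1 ∨ (u * star u).re = -1) ∧
            u * ⟨0, q.out.1.1, q.out.1.2.1, q.out.1.2.2⟩ = ⟨0, q.out.1.1, q.out.1.2.1, q.out.1.2.2⟩ * u} : ℚ))⁻¹ =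
    Nat.card (Quot (fun x y : {x : ℤ × ℤ × ℤ // x.1 ^ 2 - 3 * x.2.1 ^ 2 - 3 * x.2.2 ^ 2 = m ∧
      ∃ u : ℤ × ℤ × ℤ, u.1 * x.1 + u.2.1 * x.2.1 + u.2.2 * x.2.2 = 1} ↦
      ∃ v : ℍ[ℚ,((-1 : ℤ) : ℚ),((3 : ℤ) : ℚ)], (v ∈ order (-1) 3 ∨ v - ⟨1/2, 1/2, 1/2, -1/2⟩ ∈ order (-1) 3) ∧
        ((v * star v).re = 1 ∨ (v * star v).re = -1) ∧
        v * ⟨0, x.1.1, x.1.2.1, x.1.2.2⟩ = ⟨0, y.1.1, y.1.2.1, y.1.2.2⟩ * v)) / (if m = 1 then (4 : ℚ) else if m = 3 then 6 else 2) := by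
  haveI := finite_primitive_classes hm
  have hout := card_unitStab_primitive_mk_out m
  rw [finsum_eq_card_mul_of_forall_eq₄₄ (f := fun q : (Quot (fun x y : {x : ℤ × ℤ × ℤ // x.1 ^ 2 - 3 * x.2.1 ^ 2 - 3 * x.2.2 ^ 2 = m ∧
      ∃ u : ℤ × ℤ × ℤ, u.1 * x.1 + u.2.1 * x.2.1 + u.2.2 * x.2.2 = 1} ↦
      ∃ v : ℍ[ℚ,((-1 : ℤ) : ℚ),((3 : ℤ) : ℚ)], (v ∈ order (-1) 3 ∨ v - ⟨1/2, 1/2, 1/2, -1/2⟩ ∈ order (-1) 3) ∧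
        ((v * star v).re = 1 ∨ (v * star v).re = -1) ∧
        v * ⟨0, x.1.1, x.1.2.1, x.1.2.2⟩ = ⟨0, y.1.1, y.1.2.1, y.1.2.2⟩ * v)) ↦ ((Nat.card
          {u : ℍ[ℚ,((-1 : ℤ) : ℚ),((3 : ℤ) : ℚ)] // (u ∈ order (-1) 3 ∨ u - ⟨1/2, 1/2, 1/2, -1/2⟩ ∈ order (-1) 3) ∧
            ((u * star u).re = 1 ∨ (u * star u).re = -1) ∧
            u * ⟨0, q.out.1.1, q.out.1.2.1, q.out.1.2.2⟩ = ⟨0, q.out.1.1, q.out.1.2.1, q.out.1.2.2⟩ * u} : ℚ))⁻¹) (a := ((if m = 1 then (4 : ℚ) else if m = 3 then 6 else 2))⁻¹) ?_]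
  · exact (div_eq_mul_inv _ _).symm
  · intro q
    induction q using Quot.ind with
    | _ x =>
      show ((Nat.card {u : ℍ[ℚ,((-1 : ℤ) : ℚ),((3 : ℤ) : ℚ)] // (u ∈ order (-1) 3 ∨ u - ⟨1/2, 1/2, 1/2, -1/2⟩ ∈ order (-1) 3) ∧ ((u * star u).re = 1 ∨ (u * star u).re = -1) ∧ u * (⟨0, ((Quot.mk (fun x y : {x : ℤ × ℤ × ℤ // x.1 ^ 2 - 3 * x.2.1 ^ 2 - 3 * x.2.2 ^ 2 = m ∧
      ∃ u : ℤ × ℤ × ℤ, u.1 * x.1 + u.2.1 * x.2.1 + u.2.2 * x.2.2 = 1} ↦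
      ∃ v : ℍ[ℚ,((-1 : ℤ) : ℚ),((3 : ℤ) : ℚ)], (v ∈ order (-1) 3 ∨ v - ⟨1/2, 1/2, 1/2, -1/2⟩ ∈ order (-1) 3) ∧
        ((v * star v).re = 1 ∨ (v * star v).re = -1) ∧
        v * ⟨0, x.1.1, x.1.2.1, x.1.2.2⟩ = ⟨0, y.1.1, y.1.2.1, y.1.2.2⟩ * v) x).out).1.1, ((Quot.mk (fun x y : {x : ℤ × ℤ × ℤ // x.1 ^ 2 - 3 * x.2.1 ^ 2 - 3 * x.2.2 ^ 2 = m ∧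
      ∃ u : ℤ × ℤ × ℤ, u.1 * x.1 + u.2.1 * x.2.1 + u.2.2 * x.2.2 = 1} ↦
      ∃ v : ℍ[ℚ,((-1 : ℤ) : ℚ),((3 : ℤ) : ℚ)], (v ∈ order (-1) 3 ∨ v - ⟨1/2, 1/2, 1/2, -1/2⟩ ∈ order (-1) 3) ∧
        ((v * star v).re = 1 ∨ (v * star v).re = -1) ∧
        v * ⟨0, x.1.1, x.1.2.1, x.1.2.2⟩ = ⟨0, y.1.1, y.1.2.1, y.1.2.2⟩ * v) x).out).1.2.1, ((Quot.mk (fun x y : {x : ℤ × ℤ × ℤ // x.1 ^ 2 - 3 * x.2.1 ^ 2 - 3 * x.2.2 ^ 2 = m ∧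
      ∃ u : ℤ × ℤ × ℤ, u.1 * x.1 + u.2.1 * x.2.1 + u.2.2 * x.2.2 = 1} ↦
      ∃ v : ℍ[ℚ,((-1 : ℤ) : ℚ),((3 : ℤ) : ℚ)], (v ∈ order (-1) 3 ∨ v - ⟨1/2, 1/2, 1/2, -1/2⟩ ∈ order (-1) 3) ∧
        ((v * star v).re = 1 ∨ (v * star v).re = -1) ∧
        v * ⟨0, x.1.1, x.1.2.1, x.1.2.2⟩ = ⟨0, y.1.1, y.1.2.1, y.1.2.2⟩ * v) x).out).1.2.2⟩ : ℍ[ℚ,((-1 : ℤ) : ℚ),((3 : ℤ) : ℚ)]) = (⟨0, ((Quot.mk (fun x y : {x : ℤ × ℤ × ℤ // x.1 ^ 2 - 3 * x.2.1 ^ 2 - 3 * x.2.2 ^ 2 = m ∧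
      ∃ u : ℤ × ℤ × ℤ, u.1 * x.1 + u.2.1 * x.2.1 + u.2.2 * x.2.2 = 1} ↦
      ∃ v : ℍ[ℚ,((-1 : ℤ) : ℚ),((3 : ℤ) : ℚ)], (v ∈ order (-1) 3 ∨ v - ⟨1/2, 1/2, 1/2, -1/2⟩ ∈ order (-1) 3) ∧
        ((v * star v).re = 1 ∨ (v * star v).re = -1) ∧
        v * ⟨0, x.1.1, x.1.2.1, x.1.2.2⟩ = ⟨0, y.1.1, y.1.2.1, y.1.2.2⟩ * v) x).out).1.1, ((Quot.mk (fun x y : {x : ℤ × ℤ × ℤ // x.1 ^ 2 - 3 * x.2.1 ^ 2 - 3 * x.2.2 ^ 2 = m ∧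
      ∃ u : ℤ × ℤ × ℤ, u.1 * x.1 + u.2.1 * x.2.1 + u.2.2 * x.2.2 = 1} ↦
      ∃ v : ℍ[ℚ,((-1 : ℤ) : ℚ),((3 : ℤ) : ℚ)], (v ∈ order (-1) 3 ∨ v - ⟨1/2, 1/2, 1/2, -1/2⟩ ∈ order (-1) 3) ∧
        ((v * star v).re = 1 ∨ (v * star v).re = -1) ∧
        v * ⟨0, x.1.1, x.1.2.1, x.1.2.2⟩ = ⟨0, y.1.1, y.1.2.1, y.1.2.2⟩ * v) x).out).1.2.1, ((Quot.mk (fun x y : {x : ℤ × ℤ × ℤ // x.1 ^ 2 - 3 * x.2.1 ^ 2 - 3 * x.2.2 ^ 2 = m ∧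
      ∃ u : ℤ × ℤ × ℤ, u.1 * x.1 + u.2.1 * x.2.1 + u.2.2 * x.2.2 = 1} ↦
      ∃ v : ℍ[ℚ,((-1 : ℤ) : ℚ),((3 : ℤ) : ℚ)], (v ∈ order (-1) 3 ∨ v - ⟨1/2, 1/2, 1/2, -1/2⟩ ∈ order (-1) 3) ∧
        ((v * star v).re = 1 ∨ (v * star v).re = -1) ∧
        v * ⟨0, x.1.1, x.1.2.1, x.1.2.2⟩ = ⟨0, y.1.1, y.1.2.1, y.1.2.2⟩ * v) x).out).1.2.2⟩ : ℍ[ℚ,((-1 : ℤ) : ℚ),((3 : ℤ) : ℚ)]) * u} : ℚ))⁻¹ = _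
      rw [hout x, card_unitStab_primitive hm x.2.1 x.2.2]

end PrimitiveClasses

/-! ## §2 `deg Z(t) = Σ_{c² ∣ t} deg Z_prim(t/c²)` and Möbius inversion -/

section Decomposition

/-- **`Σᶠ_{L(t)/O₆^×} e⁻¹ = Σ_{c² ∣ t} Σᶠ_{L_prim(t/c²)/O₆^×} e⁻¹` for every `t > 0`** — the content stratification
(`finsum_unit_classes_eq_sum_content`: `Σ_c |L_c(t)/O₆^×|/w_c(t)`) with each stratum identified with the primitive classes of
norm `t/c²` (`card_stratum_eq_card_primitive`) and `w_c(t) = w(t/c²)`. [cite: KudlaRapoportYang2006, §3.4 (3.4.4)–(3.4.6) and Remark 3.4.7] [cite: VignerasLNM800, Ch. I §4 p. 26; Ch. III §5.C Cor. 5.14] -/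
theorem finsum_unit_classes_eq_sum_primitive_finsum {T : ℤ} (hT : 0 < T) :
    ∑ᶠ q : (Quot (fun x y : {x : ℤ × ℤ × ℤ // x.1 ^ 2 - 3 * x.2.1 ^ 2 - 3 * x.2.2 ^ 2 = T} ↦
      ∃ v : ℍ[ℚ,((-1 : ℤ) : ℚ),((3 : ℤ) : ℚ)], (v ∈ order (-1) 3 ∨ v - ⟨1/2, 1/2, 1/2, -1/2⟩ ∈ order (-1) 3) ∧
        ((v * star v).re = 1 ∨ (v * star v).re = -1) ∧
        v * ⟨0, x.1.1, x.1.2.1, x.1.2.2⟩ = ⟨0, y.1.1, y.1.2.1, y.1.2.2⟩ * v)),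
        ((Nat.card
          {u : ℍ[ℚ,((-1 : ℤ) : ℚ),((3 : ℤ) : ℚ)] // (u ∈ order (-1) 3 ∨ u - ⟨1/2, 1/2, 1/2, -1/2⟩ ∈ order (-1) 3) ∧
            ((u * star u).re = 1 ∨ (u * star u).re = -1) ∧
            u * ⟨0, q.out.1.1, q.out.1.2.1, q.out.1.2.2⟩ = ⟨0, q.out.1.1, q.out.1.2.1, q.out.1.2.2⟩ * u} : ℚ))⁻¹ =
    ∑ c ∈ (Finset.Icc 1 T.toNat).filter (fun c : ℕ ↦ (c : ℤ) ^ 2 ∣ T),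
      ∑ᶠ q : (Quot (fun x y : {x : ℤ × ℤ × ℤ // x.1 ^ 2 - 3 * x.2.1 ^ 2 - 3 * x.2.2 ^ 2 = T / (c : ℤ) ^ 2 ∧
      ∃ u : ℤ × ℤ × ℤ, u.1 * x.1 + u.2.1 * x.2.1 + u.2.2 * x.2.2 = 1} ↦
      ∃ v : ℍ[ℚ,((-1 : ℤ) : ℚ),((3 : ℤ) : ℚ)], (v ∈ order (-1) 3 ∨ v - ⟨1/2, 1/2, 1/2, -1/2⟩ ∈ order (-1) 3) ∧
        ((v * star v).re = 1 ∨ (v * star v).re = -1) ∧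
        v * ⟨0, x.1.1, x.1.2.1, x.1.2.2⟩ = ⟨0, y.1.1, y.1.2.1, y.1.2.2⟩ * v)),
        ((Nat.card
          {u : ℍ[ℚ,((-1 : ℤ) : ℚ),((3 : ℤ) : ℚ)] // (u ∈ order (-1) 3 ∨ u - ⟨1/2, 1/2, 1/2, -1/2⟩ ∈ order (-1) 3) ∧
            ((u * star u).re = 1 ∨ (u * star u).re = -1) ∧
            u * ⟨0, q.out.1.1, q.out.1.2.1, q.out.1.2.2⟩ = ⟨0, q.out.1.1, q.out.1.2.1, q.out.1.2.2⟩ * u} : ℚ))⁻¹ := by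
  rw [finsum_unit_classes_eq_sum_content hT, Finset.sum_filter]
  refine Finset.sum_congr rfl fun c hc ↦ ?_
  have hc0 : 0 < c := by have := (Finset.mem_Icc.1 hc).1; omega
  have hc2 : (c : ℤ) ^ 2 ≠ 0 := by positivity
  by_cases h : (c : ℤ) ^ 2 ∣ T
  · rw [if_pos h]
    have e : (c : ℤ) ^ 2 * (T / (c : ℤ) ^ 2) = T := Int.mul_ediv_cancel' h
    have ht₀ : 0 < T / (c : ℤ) ^ 2 := by
      have hc2' : (0 : ℤ) < (c : ℤ) ^ 2 := by positivity
      nlinarith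
    rw [card_stratum_eq_card_primitive hc0 e, finsum_primitive_eq_card_div ht₀]
    congr 1
    have i1 : (c : ℤ) ^ 2 = T ↔ T / (c : ℤ) ^ 2 = 1 := by
      constructor
      · intro h1; rw [← h1, Int.ediv_self hc2]
      · intro h1; rw [← e, h1, mul_one]
    have i3 : (c : ℤ) ^ 2 * 3 = T ↔ T / (c : ℤ) ^ 2 = 3 := by
      constructor
      · intro h3; rw [← h3, Int.mul_ediv_cancel_left _ hc2]
      · intro h3; rw [← e, h3]
    simp only [i1, i3]
  · rw [if_neg h, card_stratum_eq_zero_of_not_dvd h, Nat.cast_zero, zero_div]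

/-- **`deg Z(t)_ℚ = Σ_{c² ∣ t} deg Z_prim(t/c²)_ℚ` (`t > 0`): `Z(t) = Σ_{c² ∣ t} Z_prim(t/c²)` as weighted `0`-cycles on `X₆`**
— Kudla–Rapoport–Yang's decomposition (3.4.6) of `deg Z(t)` over the orders `O_{c²d}`, `c ∣ n`, on the vector side.
[cite: KudlaRapoportYang2006, §3.4 (3.4.4)–(3.4.6), Prop. 3.4.6 and Remark 3.4.7] -/
theorem degree_eq_sum_primitive_degrees {T : ℤ} (hT : 0 < T) :
    2 * ∑ᶠ q : (Quot (fun x y : {x : ℤ × ℤ × ℤ // x.1 ^ 2 - 3 * x.2.1 ^ 2 - 3 * x.2.2 ^ 2 = T} ↦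
      ∃ v : ℍ[ℚ,((-1 : ℤ) : ℚ),((3 : ℤ) : ℚ)], (v ∈ order (-1) 3 ∨ v - ⟨1/2, 1/2, 1/2, -1/2⟩ ∈ order (-1) 3) ∧
        ((v * star v).re = 1 ∨ (v * star v).re = -1) ∧
        v * ⟨0, x.1.1, x.1.2.1, x.1.2.2⟩ = ⟨0, y.1.1, y.1.2.1, y.1.2.2⟩ * v)),
        ((Nat.card
          {u : ℍ[ℚ,((-1 : ℤ) : ℚ),((3 : ℤ) : ℚ)] // (u ∈ order (-1) 3 ∨ u - ⟨1/2, 1/2, 1/2, -1/2⟩ ∈ order (-1) 3) ∧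
            ((u * star u).re = 1 ∨ (u * star u).re = -1) ∧
            u * ⟨0, q.out.1.1, q.out.1.2.1, q.out.1.2.2⟩ = ⟨0, q.out.1.1, q.out.1.2.1, q.out.1.2.2⟩ * u} : ℚ))⁻¹ =
    ∑ c ∈ (Finset.Icc 1 T.toNat).filter (fun c : ℕ ↦ (c : ℤ) ^ 2 ∣ T),
      2 * ∑ᶠ q : (Quot (fun x y : {x : ℤ × ℤ × ℤ // x.1 ^ 2 - 3 * x.2.1 ^ 2 - 3 * x.2.2 ^ 2 = T / (c : ℤ) ^ 2 ∧
      ∃ u : ℤ × ℤ × ℤ, u.1 * x.1 + u.2.1 * x.2.1 + u.2.2 * x.2.2 = 1} ↦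
      ∃ v : ℍ[ℚ,((-1 : ℤ) : ℚ),((3 : ℤ) : ℚ)], (v ∈ order (-1) 3 ∨ v - ⟨1/2, 1/2, 1/2, -1/2⟩ ∈ order (-1) 3) ∧
        ((v * star v).re = 1 ∨ (v * star v).re = -1) ∧
        v * ⟨0, x.1.1, x.1.2.1, x.1.2.2⟩ = ⟨0, y.1.1, y.1.2.1, y.1.2.2⟩ * v)),
        ((Nat.card
          {u : ℍ[ℚ,((-1 : ℤ) : ℚ),((3 : ℤ) : ℚ)] // (u ∈ order (-1) 3 ∨ u - ⟨1/2, 1/2, 1/2, -1/2⟩ ∈ order (-1) 3) ∧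
            ((u * star u).re = 1 ∨ (u * star u).re = -1) ∧
            u * ⟨0, q.out.1.1, q.out.1.2.1, q.out.1.2.2⟩ = ⟨0, q.out.1.1, q.out.1.2.1, q.out.1.2.2⟩ * u} : ℚ))⁻¹ := by
  rw [finsum_unit_classes_eq_sum_primitive_finsum hT, Finset.mul_sum]

/-- **`Σᶠ_{L(n²t₁)/O₆^×} e⁻¹ = Σ_{i ∣ n} Σᶠ_{L_prim(i²t₁)/O₆^×} e⁻¹` for `t₁` SQUAREFREE, `n ≥ 1`** — the square divisors of
`n²t₁` are the `c²`, `c ∣ n` (`filter_sq_dvd_sq_mul_eq_divisors`), and `n²t₁/c² = (n/c)²t₁`; re-index `c ↦ n/c`.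
[cite: KudlaRapoportYang2006, §3.4 (3.4.6) («`4t = n²d` … `Σ_{c∣n}`»)] [cite: Apostol1976, §2.7] -/
theorem finsum_unit_classes_sq_mul_eq_sum_divisors_finsum {t₁ : ℕ} (ht₁ : Squarefree t₁) {n : ℕ} (hn : 0 < n) :
    ∑ᶠ q : (Quot (fun x y : {x : ℤ × ℤ × ℤ // x.1 ^ 2 - 3 * x.2.1 ^ 2 - 3 * x.2.2 ^ 2 = (n : ℤ) ^ 2 * (t₁ : ℤ)} ↦
      ∃ v : ℍ[ℚ,((-1 : ℤ) : ℚ),((3 : ℤ) : ℚ)], (v ∈ order (-1) 3 ∨ v - ⟨1/2, 1/2, 1/2, -1/2⟩ ∈ order (-1) 3) ∧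
        ((v * star v).re = 1 ∨ (v * star v).re = -1) ∧
        v * ⟨0, x.1.1, x.1.2.1, x.1.2.2⟩ = ⟨0, y.1.1, y.1.2.1, y.1.2.2⟩ * v)),
        ((Nat.card
          {u : ℍ[ℚ,((-1 : ℤ) : ℚ),((3 : ℤ) : ℚ)] // (u ∈ order (-1) 3 ∨ u - ⟨1/2, 1/2, 1/2, -1/2⟩ ∈ order (-1) 3) ∧
            ((u * star u).re = 1 ∨ (u * star u).re = -1) ∧
            u * ⟨0, q.out.1.1, q.out.1.2.1, q.out.1.2.2⟩ = ⟨0, q.out.1.1, q.out.1.2.1, q.out.1.2.2⟩ * u} : ℚ))⁻¹ =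
    ∑ i ∈ n.divisors,
      ∑ᶠ q : (Quot (fun x y : {x : ℤ × ℤ × ℤ // x.1 ^ 2 - 3 * x.2.1 ^ 2 - 3 * x.2.2 ^ 2 = (i : ℤ) ^ 2 * (t₁ : ℤ) ∧
      ∃ u : ℤ × ℤ × ℤ, u.1 * x.1 + u.2.1 * x.2.1 + u.2.2 * x.2.2 = 1} ↦
      ∃ v : ℍ[ℚ,((-1 : ℤ) : ℚ),((3 : ℤ) : ℚ)], (v ∈ order (-1) 3 ∨ v - ⟨1/2, 1/2, 1/2, -1/2⟩ ∈ order (-1) 3) ∧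
        ((v * star v).re = 1 ∨ (v * star v).re = -1) ∧
        v * ⟨0, x.1.1, x.1.2.1, x.1.2.2⟩ = ⟨0, y.1.1, y.1.2.1, y.1.2.2⟩ * v)),
        ((Nat.card
          {u : ℍ[ℚ,((-1 : ℤ) : ℚ),((3 : ℤ) : ℚ)] // (u ∈ order (-1) 3 ∨ u - ⟨1/2, 1/2, 1/2, -1/2⟩ ∈ order (-1) 3) ∧
            ((u * star u).re = 1 ∨ (u * star u).re = -1) ∧
            u * ⟨0, q.out.1.1, q.out.1.2.1, q.out.1.2.2⟩ = ⟨0, q.out.1.1, q.out.1.2.1, q.out.1.2.2⟩ * u} : ℚ))⁻¹ := by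
  have ht₀ : 0 < t₁ := Nat.pos_of_ne_zero ht₁.ne_zero
  have hT : (0 : ℤ) < (n : ℤ) ^ 2 * (t₁ : ℤ) := by positivity
  rw [finsum_unit_classes_eq_sum_primitive_finsum hT, filter_sq_dvd_sq_mul_eq_divisors ht₁ hn]
  -- `have` without expected type, then `rw` (elaborating the lemma against the goal is a whnf timeout)
  have hre := (Nat.sum_div_divisors n (fun i ↦ ∑ᶠ q : (Quot (fun x y : {x : ℤ × ℤ × ℤ // x.1 ^ 2 - 3 * x.2.1 ^ 2 - 3 * x.2.2 ^ 2 = (i : ℤ) ^ 2 * (t₁ : ℤ) ∧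
      ∃ u : ℤ × ℤ × ℤ, u.1 * x.1 + u.2.1 * x.2.1 + u.2.2 * x.2.2 = 1} ↦
      ∃ v : ℍ[ℚ,((-1 : ℤ) : ℚ),((3 : ℤ) : ℚ)], (v ∈ order (-1) 3 ∨ v - ⟨1/2, 1/2, 1/2, -1/2⟩ ∈ order (-1) 3) ∧
        ((v * star v).re = 1 ∨ (v * star v).re = -1) ∧
        v * ⟨0, x.1.1, x.1.2.1, x.1.2.2⟩ = ⟨0, y.1.1, y.1.2.1, y.1.2.2⟩ * v)),
        ((Nat.card
          {u : ℍ[ℚ,((-1 : ℤ) : ℚ),((3 : ℤ) : ℚ)] // (u ∈ order (-1) 3 ∨ u - ⟨1/2, 1/2, 1/2, -1/2⟩ ∈ order (-1) 3) ∧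
            ((u * star u).re = 1 ∨ (u * star u).re = -1) ∧
            u * ⟨0, q.out.1.1, q.out.1.2.1, q.out.1.2.2⟩ = ⟨0, q.out.1.1, q.out.1.2.1, q.out.1.2.2⟩ * u} : ℚ))⁻¹)).symm
  rw [hre]
  refine Finset.sum_congr rfl fun c hc ↦ ?_
  obtain ⟨hcn, -⟩ := Nat.mem_divisors.1 hc
  obtain ⟨k, rfl⟩ := hcn
  have hc0 : 0 < c := Nat.pos_of_ne_zero (by rintro rfl; simp at hn)
  refine finsum_primitive_congr₄₄ ?_
  rw [Nat.mul_div_cancel_left k hc0]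
  push_cast
  rw [show ((c : ℤ) * (k : ℤ)) ^ 2 * (t₁ : ℤ) = (c : ℤ) ^ 2 * ((k : ℤ) ^ 2 * (t₁ : ℤ)) by ring,
    Int.mul_ediv_cancel_left _ (by positivity : (c : ℤ) ^ 2 ≠ 0)]

/-- **MÖBIUS INVERSION FOR THE PRIMITIVE DEGREES: `Σᶠ_{L_prim(n²t₁)/O₆^×} e⁻¹ = Σ_{ab = n} μ(a)·Σᶠ_{L(b²t₁)/O₆^×} e⁻¹`**
(`t₁` squarefree, `n ≥ 1`; Mathlib's `ArithmeticFunction.sum_eq_iff_sum_mul_moebius_eq` over `ℚ`).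
[cite: Apostol1976, §2.7 Thm. 2.9] [cite: KudlaRapoportYang2006, §3.4 (3.4.6) and (3.4.14)] -/
theorem finsum_primitive_eq_sum_moebius {t₁ : ℕ} (ht₁ : Squarefree t₁) {n : ℕ} (hn : 0 < n) :
    ∑ᶠ q : (Quot (fun x y : {x : ℤ × ℤ × ℤ // x.1 ^ 2 - 3 * x.2.1 ^ 2 - 3 * x.2.2 ^ 2 = (n : ℤ) ^ 2 * (t₁ : ℤ) ∧
      ∃ u : ℤ × ℤ × ℤ, u.1 * x.1 + u.2.1 * x.2.1 + u.2.2 * x.2.2 = 1} ↦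
      ∃ v : ℍ[ℚ,((-1 : ℤ) : ℚ),((3 : ℤ) : ℚ)], (v ∈ order (-1) 3 ∨ v - ⟨1/2, 1/2, 1/2, -1/2⟩ ∈ order (-1) 3) ∧
        ((v * star v).re = 1 ∨ (v * star v).re = -1) ∧
        v * ⟨0, x.1.1, x.1.2.1, x.1.2.2⟩ = ⟨0, y.1.1, y.1.2.1, y.1.2.2⟩ * v)),
        ((Nat.card
          {u : ℍ[ℚ,((-1 : ℤ) : ℚ),((3 : ℤ) : ℚ)] // (u ∈ order (-1) 3 ∨ u - ⟨1/2, 1/2, 1/2, -1/2⟩ ∈ order (-1) 3) ∧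
            ((u * star u).re = 1 ∨ (u * star u).re = -1) ∧
            u * ⟨0, q.out.1.1, q.out.1.2.1, q.out.1.2.2⟩ = ⟨0, q.out.1.1, q.out.1.2.1, q.out.1.2.2⟩ * u} : ℚ))⁻¹ =
    ∑ ab ∈ n.divisorsAntidiagonal, (ArithmeticFunction.moebius ab.1 : ℚ) *
      ∑ᶠ q : (Quot (fun x y : {x : ℤ × ℤ × ℤ // x.1 ^ 2 - 3 * x.2.1 ^ 2 - 3 * x.2.2 ^ 2 = (ab.2 : ℤ) ^ 2 * (t₁ : ℤ)} ↦
      ∃ v : ℍ[ℚ,((-1 : ℤ) : ℚ),((3 : ℤ) : ℚ)], (v ∈ order (-1) 3 ∨ v - ⟨1/2, 1/2, 1/2, -1/2⟩ ∈ order (-1) 3) ∧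
        ((v * star v).re = 1 ∨ (v * star v).re = -1) ∧
        v * ⟨0, x.1.1, x.1.2.1, x.1.2.2⟩ = ⟨0, y.1.1, y.1.2.1, y.1.2.2⟩ * v)),
        ((Nat.card
          {u : ℍ[ℚ,((-1 : ℤ) : ℚ),((3 : ℤ) : ℚ)] // (u ∈ order (-1) 3 ∨ u - ⟨1/2, 1/2, 1/2, -1/2⟩ ∈ order (-1) 3) ∧
            ((u * star u).re = 1 ∨ (u * star u).re = -1) ∧
            u * ⟨0, q.out.1.1, q.out.1.2.1, q.out.1.2.2⟩ = ⟨0, q.out.1.1, q.out.1.2.1, q.out.1.2.2⟩ * u} : ℚ))⁻¹ := by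
  -- let `f`, `g` be inferred by pattern unification from `H` (explicit lambdas here are a whnf timeout)
  have H : ∀ m : ℕ, 0 < m → ∑ i ∈ m.divisors,
      ∑ᶠ q : (Quot (fun x y : {x : ℤ × ℤ × ℤ // x.1 ^ 2 - 3 * x.2.1 ^ 2 - 3 * x.2.2 ^ 2 = (i : ℤ) ^ 2 * (t₁ : ℤ) ∧
      ∃ u : ℤ × ℤ × ℤ, u.1 * x.1 + u.2.1 * x.2.1 + u.2.2 * x.2.2 = 1} ↦
      ∃ v : ℍ[ℚ,((-1 : ℤ) : ℚ),((3 : ℤ) : ℚ)], (v ∈ order (-1) 3 ∨ v - ⟨1/2, 1/2, 1/2, -1/2⟩ ∈ order (-1) 3) ∧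
        ((v * star v).re = 1 ∨ (v * star v).re = -1) ∧
        v * ⟨0, x.1.1, x.1.2.1, x.1.2.2⟩ = ⟨0, y.1.1, y.1.2.1, y.1.2.2⟩ * v)),
        ((Nat.card
          {u : ℍ[ℚ,((-1 : ℤ) : ℚ),((3 : ℤ) : ℚ)] // (u ∈ order (-1) 3 ∨ u - ⟨1/2, 1/2, 1/2, -1/2⟩ ∈ order (-1) 3) ∧
            ((u * star u).re = 1 ∨ (u * star u).re = -1) ∧
            u * ⟨0, q.out.1.1, q.out.1.2.1, q.out.1.2.2⟩ = ⟨0, q.out.1.1, q.out.1.2.1, q.out.1.2.2⟩ * u} : ℚ))⁻¹ =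
      ∑ᶠ q : (Quot (fun x y : {x : ℤ × ℤ × ℤ // x.1 ^ 2 - 3 * x.2.1 ^ 2 - 3 * x.2.2 ^ 2 = (m : ℤ) ^ 2 * (t₁ : ℤ)} ↦
      ∃ v : ℍ[ℚ,((-1 : ℤ) : ℚ),((3 : ℤ) : ℚ)], (v ∈ order (-1) 3 ∨ v - ⟨1/2, 1/2, 1/2, -1/2⟩ ∈ order (-1) 3) ∧
        ((v * star v).re = 1 ∨ (v * star v).re = -1) ∧
        v * ⟨0, x.1.1, x.1.2.1, x.1.2.2⟩ = ⟨0, y.1.1, y.1.2.1, y.1.2.2⟩ * v)),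
        ((Nat.card
          {u : ℍ[ℚ,((-1 : ℤ) : ℚ),((3 : ℤ) : ℚ)] // (u ∈ order (-1) 3 ∨ u - ⟨1/2, 1/2, 1/2, -1/2⟩ ∈ order (-1) 3) ∧
            ((u * star u).re = 1 ∨ (u * star u).re = -1) ∧
            u * ⟨0, q.out.1.1, q.out.1.2.1, q.out.1.2.2⟩ = ⟨0, q.out.1.1, q.out.1.2.1, q.out.1.2.2⟩ * u} : ℚ))⁻¹ :=
    fun m hm ↦ (finsum_unit_classes_sq_mul_eq_sum_divisors_finsum ht₁ hm).symm
  have key := ArithmeticFunction.sum_eq_iff_sum_mul_moebius_eq.1 H n hn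
  exact key.symm

/-- **`deg Z_prim(n²t₁)_ℚ = Σ_{ab = n} μ(a)·deg Z(b²t₁)_ℚ`** (`t₁` squarefree, `n ≥ 1`) — the primitive special cycles are
integral Möbius combinations of Kudla–Rapoport–Yang's `Z(t)`. [cite: Apostol1976, §2.7 Thm. 2.9] [cite: KudlaRapoportYang2006, §3.4 (3.4.6), (3.4.14) and Prop. 3.4.6] -/
theorem degree_primitive_eq_sum_moebius {t₁ : ℕ} (ht₁ : Squarefree t₁) {n : ℕ} (hn : 0 < n) :
    2 * ∑ᶠ q : (Quot (fun x y : {x : ℤ × ℤ × ℤ // x.1 ^ 2 - 3 * x.2.1 ^ 2 - 3 * x.2.2 ^ 2 = (n : ℤ) ^ 2 * (t₁ : ℤ) ∧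
      ∃ u : ℤ × ℤ × ℤ, u.1 * x.1 + u.2.1 * x.2.1 + u.2.2 * x.2.2 = 1} ↦
      ∃ v : ℍ[ℚ,((-1 : ℤ) : ℚ),((3 : ℤ) : ℚ)], (v ∈ order (-1) 3 ∨ v - ⟨1/2, 1/2, 1/2, -1/2⟩ ∈ order (-1) 3) ∧
        ((v * star v).re = 1 ∨ (v * star v).re = -1) ∧
        v * ⟨0, x.1.1, x.1.2.1, x.1.2.2⟩ = ⟨0, y.1.1, y.1.2.1, y.1.2.2⟩ * v)),
        ((Nat.card
          {u : ℍ[ℚ,((-1 : ℤ) : ℚ),((3 : ℤ) : ℚ)] // (u ∈ order (-1) 3 ∨ u - ⟨1/2, 1/2, 1/2, -1/2⟩ ∈ order (-1) 3) ∧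
            ((u * star u).re = 1 ∨ (u * star u).re = -1) ∧
            u * ⟨0, q.out.1.1, q.out.1.2.1, q.out.1.2.2⟩ = ⟨0, q.out.1.1, q.out.1.2.1, q.out.1.2.2⟩ * u} : ℚ))⁻¹ =
    ∑ ab ∈ n.divisorsAntidiagonal, (ArithmeticFunction.moebius ab.1 : ℚ) *
      (2 * ∑ᶠ q : (Quot (fun x y : {x : ℤ × ℤ × ℤ // x.1 ^ 2 - 3 * x.2.1 ^ 2 - 3 * x.2.2 ^ 2 = (ab.2 : ℤ) ^ 2 * (t₁ : ℤ)} ↦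
      ∃ v : ℍ[ℚ,((-1 : ℤ) : ℚ),((3 : ℤ) : ℚ)], (v ∈ order (-1) 3 ∨ v - ⟨1/2, 1/2, 1/2, -1/2⟩ ∈ order (-1) 3) ∧
        ((v * star v).re = 1 ∨ (v * star v).re = -1) ∧
        v * ⟨0, x.1.1, x.1.2.1, x.1.2.2⟩ = ⟨0, y.1.1, y.1.2.1, y.1.2.2⟩ * v)),
        ((Nat.card
          {u : ℍ[ℚ,((-1 : ℤ) : ℚ),((3 : ℤ) : ℚ)] // (u ∈ order (-1) 3 ∨ u - ⟨1/2, 1/2, 1/2, -1/2⟩ ∈ order (-1) 3) ∧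
            ((u * star u).re = 1 ∨ (u * star u).re = -1) ∧
            u * ⟨0, q.out.1.1, q.out.1.2.1, q.out.1.2.2⟩ = ⟨0, q.out.1.1, q.out.1.2.1, q.out.1.2.2⟩ * u} : ℚ))⁻¹) := by
  rw [finsum_primitive_eq_sum_moebius ht₁ hn, Finset.mul_sum]
  refine Finset.sum_congr rfl fun ab _ ↦ ?_
  ring

end Decomposition

/-! ## §3 Values and the decompositions of `Z(25)`, `Z(75)` -/

section Values

/-- **`deg Z_prim(1)_ℚ = 2·P(1)/w(1) = 2·2/4 = 1`** (`= deg Z(1)_ℚ`: every vector of norm `1` is primitive). [cite: KudlaRapoportYang2006, §3.4 (3.4.8) and Lemma 3.4.3] -/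
theorem degree_primitive_one :
    2 * ∑ᶠ q : (Quot (fun x y : {x : ℤ × ℤ × ℤ // x.1 ^ 2 - 3 * x.2.1 ^ 2 - 3 * x.2.2 ^ 2 = 1 ∧
      ∃ u : ℤ × ℤ × ℤ, u.1 * x.1 + u.2.1 * x.2.1 + u.2.2 * x.2.2 = 1} ↦
      ∃ v : ℍ[ℚ,((-1 : ℤ) : ℚ),((3 : ℤ) : ℚ)], (v ∈ order (-1) 3 ∨ v - ⟨1/2, 1/2, 1/2, -1/2⟩ ∈ order (-1) 3) ∧
        ((v * star v).re = 1 ∨ (v * star v).re = -1) ∧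
        v * ⟨0, x.1.1, x.1.2.1, x.1.2.2⟩ = ⟨0, y.1.1, y.1.2.1, y.1.2.2⟩ * v)),
        ((Nat.card
          {u : ℍ[ℚ,((-1 : ℤ) : ℚ),((3 : ℤ) : ℚ)] // (u ∈ order (-1) 3 ∨ u - ⟨1/2, 1/2, 1/2, -1/2⟩ ∈ order (-1) 3) ∧
            ((u * star u).re = 1 ∨ (u * star u).re = -1) ∧
            u * ⟨0, q.out.1.1, q.out.1.2.1, q.out.1.2.2⟩ = ⟨0, q.out.1.1, q.out.1.2.1, q.out.1.2.2⟩ * u} : ℚ))⁻¹ = 1 := by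
  rw [finsum_primitive_eq_card_div one_pos, card_primitive_one]
  norm_num

/-- **`deg Z_prim(3)_ℚ = 2·2/6 = 2/3`** (`= deg Z(3)_ℚ`). [cite: KudlaRapoportYang2006, §3.4 (3.4.8)] -/
theorem degree_primitive_three :
    2 * ∑ᶠ q : (Quot (fun x y : {x : ℤ × ℤ × ℤ // x.1 ^ 2 - 3 * x.2.1 ^ 2 - 3 * x.2.2 ^ 2 = 3 ∧
      ∃ u : ℤ × ℤ × ℤ, u.1 * x.1 + u.2.1 * x.2.1 + u.2.2 * x.2.2 = 1} ↦
      ∃ v : ℍ[ℚ,((-1 : ℤ) : ℚ),((3 : ℤ) : ℚ)], (v ∈ order (-1) 3 ∨ v - ⟨1/2, 1/2, 1/2, -1/2⟩ ∈ order (-1) 3) ∧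
        ((v * star v).re = 1 ∨ (v * star v).re = -1) ∧
        v * ⟨0, x.1.1, x.1.2.1, x.1.2.2⟩ = ⟨0, y.1.1, y.1.2.1, y.1.2.2⟩ * v)),
        ((Nat.card
          {u : ℍ[ℚ,((-1 : ℤ) : ℚ),((3 : ℤ) : ℚ)] // (u ∈ order (-1) 3 ∨ u - ⟨1/2, 1/2, 1/2, -1/2⟩ ∈ order (-1) 3) ∧
            ((u * star u).re = 1 ∨ (u * star u).re = -1) ∧
            u * ⟨0, q.out.1.1, q.out.1.2.1, q.out.1.2.2⟩ = ⟨0, q.out.1.1, q.out.1.2.1, q.out.1.2.2⟩ * u} : ℚ))⁻¹ = 2 / 3 := by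
  rw [finsum_primitive_eq_card_div (by norm_num : (0 : ℤ) < 3), card_primitive_three]
  norm_num

/-- **`deg Z_prim(25)_ℚ = 2·P(25)/2 = 4`** — the term `c = 1` of KRY's `Σ_{c∣5}` for `t = 25` (`4t = 10²·(−4)`… `d = −4`,
`n = 10`, `(c,6) = 1`): `δ(−4·25; 6)·h(−100)/… `, on the vector side `2·4/2`. [cite: KudlaRapoportYang2006, §3.4 (3.4.6)] [cite: VignerasLNM800, Ch. III §5.C Cor. 5.12] -/
theorem degree_primitive_twentyfive :
    2 * ∑ᶠ q : (Quot (fun x y : {x : ℤ × ℤ × ℤ // x.1 ^ 2 - 3 * x.2.1 ^ 2 - 3 * x.2.2 ^ 2 = 25 ∧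
      ∃ u : ℤ × ℤ × ℤ, u.1 * x.1 + u.2.1 * x.2.1 + u.2.2 * x.2.2 = 1} ↦
      ∃ v : ℍ[ℚ,((-1 : ℤ) : ℚ),((3 : ℤ) : ℚ)], (v ∈ order (-1) 3 ∨ v - ⟨1/2, 1/2, 1/2, -1/2⟩ ∈ order (-1) 3) ∧
        ((v * star v).re = 1 ∨ (v * star v).re = -1) ∧
        v * ⟨0, x.1.1, x.1.2.1, x.1.2.2⟩ = ⟨0, y.1.1, y.1.2.1, y.1.2.2⟩ * v)),
        ((Nat.card
          {u : ℍ[ℚ,((-1 : ℤ) : ℚ),((3 : ℤ) : ℚ)] // (u ∈ order (-1) 3 ∨ u - ⟨1/2, 1/2, 1/2, -1/2⟩ ∈ order (-1) 3) ∧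
            ((u * star u).re = 1 ∨ (u * star u).re = -1) ∧
            u * ⟨0, q.out.1.1, q.out.1.2.1, q.out.1.2.2⟩ = ⟨0, q.out.1.1, q.out.1.2.1, q.out.1.2.2⟩ * u} : ℚ))⁻¹ = 4 := by
  rw [finsum_primitive_eq_card_div (by norm_num : (0 : ℤ) < 25), card_primitive_twentyfive]
  norm_num

/-- **`deg Z_prim(75)_ℚ = 2·P(75)/2 = 4`.** [cite: KudlaRapoportYang2006, §3.4 (3.4.6)] [cite: VignerasLNM800, Ch. III §5.C Cor. 5.12] -/
theorem degree_primitive_seventyfive :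
    2 * ∑ᶠ q : (Quot (fun x y : {x : ℤ × ℤ × ℤ // x.1 ^ 2 - 3 * x.2.1 ^ 2 - 3 * x.2.2 ^ 2 = 75 ∧
      ∃ u : ℤ × ℤ × ℤ, u.1 * x.1 + u.2.1 * x.2.1 + u.2.2 * x.2.2 = 1} ↦
      ∃ v : ℍ[ℚ,((-1 : ℤ) : ℚ),((3 : ℤ) : ℚ)], (v ∈ order (-1) 3 ∨ v - ⟨1/2, 1/2, 1/2, -1/2⟩ ∈ order (-1) 3) ∧
        ((v * star v).re = 1 ∨ (v * star v).re = -1) ∧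
        v * ⟨0, x.1.1, x.1.2.1, x.1.2.2⟩ = ⟨0, y.1.1, y.1.2.1, y.1.2.2⟩ * v)),
        ((Nat.card
          {u : ℍ[ℚ,((-1 : ℤ) : ℚ),((3 : ℤ) : ℚ)] // (u ∈ order (-1) 3 ∨ u - ⟨1/2, 1/2, 1/2, -1/2⟩ ∈ order (-1) 3) ∧
            ((u * star u).re = 1 ∨ (u * star u).re = -1) ∧
            u * ⟨0, q.out.1.1, q.out.1.2.1, q.out.1.2.2⟩ = ⟨0, q.out.1.1, q.out.1.2.1, q.out.1.2.2⟩ * u} : ℚ))⁻¹ = 4 := by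
  rw [finsum_primitive_eq_card_div (by norm_num : (0 : ℤ) < 75), card_primitive_seventyfive]
  norm_num

/-- **`deg Z_prim(100)_ℚ = 0`** (no primitive vector of norm divisible by `4`: the order of conductor `10` in `ℚ(i)` is not
maximal at the ramified prime `2`). [cite: KudlaRapoportYang2006, §3.4 (3.4.6) («`(c, D) = 1`») and Remark 3.4.7] -/
theorem degree_primitive_hundred :
    2 * ∑ᶠ q : (Quot (fun x y : {x : ℤ × ℤ × ℤ // x.1 ^ 2 - 3 * x.2.1 ^ 2 - 3 * x.2.2 ^ 2 = 100 ∧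
      ∃ u : ℤ × ℤ × ℤ, u.1 * x.1 + u.2.1 * x.2.1 + u.2.2 * x.2.2 = 1} ↦
      ∃ v : ℍ[ℚ,((-1 : ℤ) : ℚ),((3 : ℤ) : ℚ)], (v ∈ order (-1) 3 ∨ v - ⟨1/2, 1/2, 1/2, -1/2⟩ ∈ order (-1) 3) ∧
        ((v * star v).re = 1 ∨ (v * star v).re = -1) ∧
        v * ⟨0, x.1.1, x.1.2.1, x.1.2.2⟩ = ⟨0, y.1.1, y.1.2.1, y.1.2.2⟩ * v)),
        ((Nat.card
          {u : ℍ[ℚ,((-1 : ℤ) : ℚ),((3 : ℤ) : ℚ)] // (u ∈ order (-1) 3 ∨ u - ⟨1/2, 1/2, 1/2, -1/2⟩ ∈ order (-1) 3) ∧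
            ((u * star u).re = 1 ∨ (u * star u).re = -1) ∧
            u * ⟨0, q.out.1.1, q.out.1.2.1, q.out.1.2.2⟩ = ⟨0, q.out.1.1, q.out.1.2.1, q.out.1.2.2⟩ * u} : ℚ))⁻¹ = 0 := by
  rw [finsum_primitive_eq_card_div (by norm_num : (0 : ℤ) < 100), card_primitive_hundred]
  norm_num

/-- **`deg Z(25)_ℚ = deg Z_prim(25)_ℚ + deg Z_prim(1)_ℚ` (`= 4 + 1 = 5`)**: `25 = 5²·1`, divisors `{1, 5}` — the two orders
`ℤ[5i]` (conductor `5`) and `ℤ[i]` of KRY's `Σ_{c∣n}`. [cite: KudlaRapoportYang2006, §3.4 (3.4.6) and Prop. 3.4.6] -/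
theorem degree_twentyfive_eq_primitive_add :
    2 * ∑ᶠ q : (Quot (fun x y : {x : ℤ × ℤ × ℤ // x.1 ^ 2 - 3 * x.2.1 ^ 2 - 3 * x.2.2 ^ 2 = 25} ↦
      ∃ v : ℍ[ℚ,((-1 : ℤ) : ℚ),((3 : ℤ) : ℚ)], (v ∈ order (-1) 3 ∨ v - ⟨1/2, 1/2, 1/2, -1/2⟩ ∈ order (-1) 3) ∧
        ((v * star v).re = 1 ∨ (v * star v).re = -1) ∧
        v * ⟨0, x.1.1, x.1.2.1, x.1.2.2⟩ = ⟨0, y.1.1, y.1.2.1, y.1.2.2⟩ * v)),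
        ((Nat.card
          {u : ℍ[ℚ,((-1 : ℤ) : ℚ),((3 : ℤ) : ℚ)] // (u ∈ order (-1) 3 ∨ u - ⟨1/2, 1/2, 1/2, -1/2⟩ ∈ order (-1) 3) ∧
            ((u * star u).re = 1 ∨ (u * star u).re = -1) ∧
            u * ⟨0, q.out.1.1, q.out.1.2.1, q.out.1.2.2⟩ = ⟨0, q.out.1.1, q.out.1.2.1, q.out.1.2.2⟩ * u} : ℚ))⁻¹ =
    2 * ∑ᶠ q : (Quot (fun x y : {x : ℤ × ℤ × ℤ // x.1 ^ 2 - 3 * x.2.1 ^ 2 - 3 * x.2.2 ^ 2 = 25 ∧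
      ∃ u : ℤ × ℤ × ℤ, u.1 * x.1 + u.2.1 * x.2.1 + u.2.2 * x.2.2 = 1} ↦
      ∃ v : ℍ[ℚ,((-1 : ℤ) : ℚ),((3 : ℤ) : ℚ)], (v ∈ order (-1) 3 ∨ v - ⟨1/2, 1/2, 1/2, -1/2⟩ ∈ order (-1) 3) ∧
        ((v * star v).re = 1 ∨ (v * star v).re = -1) ∧
        v * ⟨0, x.1.1, x.1.2.1, x.1.2.2⟩ = ⟨0, y.1.1, y.1.2.1, y.1.2.2⟩ * v)),
        ((Nat.card
          {u : ℍ[ℚ,((-1 : ℤ) : ℚ),((3 : ℤ) : ℚ)] // (u ∈ order (-1) 3 ∨ u - ⟨1/2, 1/2, 1/2, -1/2⟩ ∈ order (-1) 3) ∧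
            ((u * star u).re = 1 ∨ (u * star u).re = -1) ∧
            u * ⟨0, q.out.1.1, q.out.1.2.1, q.out.1.2.2⟩ = ⟨0, q.out.1.1, q.out.1.2.1, q.out.1.2.2⟩ * u} : ℚ))⁻¹ +
    2 * ∑ᶠ q : (Quot (fun x y : {x : ℤ × ℤ × ℤ // x.1 ^ 2 - 3 * x.2.1 ^ 2 - 3 * x.2.2 ^ 2 = 1 ∧
      ∃ u : ℤ × ℤ × ℤ, u.1 * x.1 + u.2.1 * x.2.1 + u.2.2 * x.2.2 = 1} ↦
      ∃ v : ℍ[ℚ,((-1 : ℤ) : ℚ),((3 : ℤ) : ℚ)], (v ∈ order (-1) 3 ∨ v - ⟨1/2, 1/2, 1/2, -1/2⟩ ∈ order (-1) 3) ∧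
        ((v * star v).re = 1 ∨ (v * star v).re = -1) ∧
        v * ⟨0, x.1.1, x.1.2.1, x.1.2.2⟩ = ⟨0, y.1.1, y.1.2.1, y.1.2.2⟩ * v)),
        ((Nat.card
          {u : ℍ[ℚ,((-1 : ℤ) : ℚ),((3 : ℤ) : ℚ)] // (u ∈ order (-1) 3 ∨ u - ⟨1/2, 1/2, 1/2, -1/2⟩ ∈ order (-1) 3) ∧
            ((u * star u).re = 1 ∨ (u * star u).re = -1) ∧
            u * ⟨0, q.out.1.1, q.out.1.2.1, q.out.1.2.2⟩ = ⟨0, q.out.1.1, q.out.1.2.1, q.out.1.2.2⟩ * u} : ℚ))⁻¹ := by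
  have h := finsum_unit_classes_sq_mul_eq_sum_divisors_finsum squarefree_one (n := 5) (by norm_num)
  rw [Nat.Prime.divisors Nat.prime_five, Finset.sum_pair (show (1 : ℕ) ≠ 5 by decide),
    finsum_unit_congr₄₄ (show ((5 : ℕ) : ℤ) ^ 2 * ((1 : ℕ) : ℤ) = 25 by norm_num),
    finsum_primitive_congr₄₄ (show ((1 : ℕ) : ℤ) ^ 2 * ((1 : ℕ) : ℤ) = 1 by norm_num),
    finsum_primitive_congr₄₄ (show ((5 : ℕ) : ℤ) ^ 2 * ((1 : ℕ) : ℤ) = 25 by norm_num)] at h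
  rw [h]
  ring

/-- **`deg Z(75)_ℚ = deg Z_prim(75)_ℚ + deg Z_prim(3)_ℚ` (`= 4 + 2/3 = 14/3`)**: `75 = 5²·3`, divisors `{1, 5}` — the orders of
conductor `5` and `1` in `ℚ(√−3)`. [cite: KudlaRapoportYang2006, §3.4 (3.4.6) and Prop. 3.4.6] -/
theorem degree_seventyfive_eq_primitive_add :
    2 * ∑ᶠ q : (Quot (fun x y : {x : ℤ × ℤ × ℤ // x.1 ^ 2 - 3 * x.2.1 ^ 2 - 3 * x.2.2 ^ 2 = 75} ↦
      ∃ v : ℍ[ℚ,((-1 : ℤ) : ℚ),((3 : ℤ) : ℚ)], (v ∈ order (-1) 3 ∨ v - ⟨1/2, 1/2, 1/2, -1/2⟩ ∈ order (-1) 3) ∧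
        ((v * star v).re = 1 ∨ (v * star v).re = -1) ∧
        v * ⟨0, x.1.1, x.1.2.1, x.1.2.2⟩ = ⟨0, y.1.1, y.1.2.1, y.1.2.2⟩ * v)),
        ((Nat.card
          {u : ℍ[ℚ,((-1 : ℤ) : ℚ),((3 : ℤ) : ℚ)] // (u ∈ order (-1) 3 ∨ u - ⟨1/2, 1/2, 1/2, -1/2⟩ ∈ order (-1) 3) ∧
            ((u * star u).re = 1 ∨ (u * star u).re = -1) ∧
            u * ⟨0, q.out.1.1, q.out.1.2.1, q.out.1.2.2⟩ = ⟨0, q.out.1.1, q.out.1.2.1, q.out.1.2.2⟩ * u} : ℚ))⁻¹ =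
    2 * ∑ᶠ q : (Quot (fun x y : {x : ℤ × ℤ × ℤ // x.1 ^ 2 - 3 * x.2.1 ^ 2 - 3 * x.2.2 ^ 2 = 75 ∧
      ∃ u : ℤ × ℤ × ℤ, u.1 * x.1 + u.2.1 * x.2.1 + u.2.2 * x.2.2 = 1} ↦
      ∃ v : ℍ[ℚ,((-1 : ℤ) : ℚ),((3 : ℤ) : ℚ)], (v ∈ order (-1) 3 ∨ v - ⟨1/2, 1/2, 1/2, -1/2⟩ ∈ order (-1) 3) ∧
        ((v * star v).re = 1 ∨ (v * star v).re = -1) ∧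
        v * ⟨0, x.1.1, x.1.2.1, x.1.2.2⟩ = ⟨0, y.1.1, y.1.2.1, y.1.2.2⟩ * v)),
        ((Nat.card
          {u : ℍ[ℚ,((-1 : ℤ) : ℚ),((3 : ℤ) : ℚ)] // (u ∈ order (-1) 3 ∨ u - ⟨1/2, 1/2, 1/2, -1/2⟩ ∈ order (-1) 3) ∧
            ((u * star u).re = 1 ∨ (u * star u).re = -1) ∧
            u * ⟨0, q.out.1.1, q.out.1.2.1, q.out.1.2.2⟩ = ⟨0, q.out.1.1, q.out.1.2.1, q.out.1.2.2⟩ * u} : ℚ))⁻¹ +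
    2 * ∑ᶠ q : (Quot (fun x y : {x : ℤ × ℤ × ℤ // x.1 ^ 2 - 3 * x.2.1 ^ 2 - 3 * x.2.2 ^ 2 = 3 ∧
      ∃ u : ℤ × ℤ × ℤ, u.1 * x.1 + u.2.1 * x.2.1 + u.2.2 * x.2.2 = 1} ↦
      ∃ v : ℍ[ℚ,((-1 : ℤ) : ℚ),((3 : ℤ) : ℚ)], (v ∈ order (-1) 3 ∨ v - ⟨1/2, 1/2, 1/2, -1/2⟩ ∈ order (-1) 3) ∧
        ((v * star v).re = 1 ∨ (v * star v).re = -1) ∧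
        v * ⟨0, x.1.1, x.1.2.1, x.1.2.2⟩ = ⟨0, y.1.1, y.1.2.1, y.1.2.2⟩ * v)),
        ((Nat.card
          {u : ℍ[ℚ,((-1 : ℤ) : ℚ),((3 : ℤ) : ℚ)] // (u ∈ order (-1) 3 ∨ u - ⟨1/2, 1/2, 1/2, -1/2⟩ ∈ order (-1) 3) ∧
            ((u * star u).re = 1 ∨ (u * star u).re = -1) ∧
            u * ⟨0, q.out.1.1, q.out.1.2.1, q.out.1.2.2⟩ = ⟨0, q.out.1.1, q.out.1.2.1, q.out.1.2.2⟩ * u} : ℚ))⁻¹ := by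
  have h3 : Squarefree (3 : ℕ) := Nat.prime_three.prime.squarefree
  have h := finsum_unit_classes_sq_mul_eq_sum_divisors_finsum h3 (n := 5) (by norm_num)
  rw [Nat.Prime.divisors Nat.prime_five, Finset.sum_pair (show (1 : ℕ) ≠ 5 by decide),
    finsum_unit_congr₄₄ (show ((5 : ℕ) : ℤ) ^ 2 * ((3 : ℕ) : ℤ) = 75 by norm_num),
    finsum_primitive_congr₄₄ (show ((1 : ℕ) : ℤ) ^ 2 * ((3 : ℕ) : ℤ) = 3 by norm_num),
    finsum_primitive_congr₄₄ (show ((5 : ℕ) : ℤ) ^ 2 * ((3 : ℕ) : ℤ) = 75 by norm_num)] at h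
  rw [h]
  ring

/-- **Consistency with the degree table: `deg Z(25)_ℚ = 4 + 1 = 5` recovered from the primitive decomposition.**
[cite: KudlaRapoportYang2006, §3.4 (3.4.6) and Prop. 3.4.6] -/
theorem degree_value_twentyfive_of_primitive :
    2 * ∑ᶠ q : (Quot (fun x y : {x : ℤ × ℤ × ℤ // x.1 ^ 2 - 3 * x.2.1 ^ 2 - 3 * x.2.2 ^ 2 = 25} ↦
      ∃ v : ℍ[ℚ,((-1 : ℤ) : ℚ),((3 : ℤ) : ℚ)], (v ∈ order (-1) 3 ∨ v - ⟨1/2, 1/2, 1/2, -1/2⟩ ∈ order (-1) 3) ∧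
        ((v * star v).re = 1 ∨ (v * star v).re = -1) ∧
        v * ⟨0, x.1.1, x.1.2.1, x.1.2.2⟩ = ⟨0, y.1.1, y.1.2.1, y.1.2.2⟩ * v)),
        ((Nat.card
          {u : ℍ[ℚ,((-1 : ℤ) : ℚ),((3 : ℤ) : ℚ)] // (u ∈ order (-1) 3 ∨ u - ⟨1/2, 1/2, 1/2, -1/2⟩ ∈ order (-1) 3) ∧
            ((u * star u).re = 1 ∨ (u * star u).re = -1) ∧
            u * ⟨0, q.out.1.1, q.out.1.2.1, q.out.1.2.2⟩ = ⟨0, q.out.1.1, q.out.1.2.1, q.out.1.2.2⟩ * u} : ℚ))⁻¹ = 4 + 1 := by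
  rw [degree_twentyfive_eq_primitive_add, degree_primitive_twentyfive, degree_primitive_one]

/-- **Consistency: `deg Z(75)_ℚ = 4 + 2/3 = 14/3` from the primitive decomposition.** [cite: KudlaRapoportYang2006, §3.4 (3.4.6) and Prop. 3.4.6] -/
theorem degree_value_seventyfive_of_primitive :
    2 * ∑ᶠ q : (Quot (fun x y : {x : ℤ × ℤ × ℤ // x.1 ^ 2 - 3 * x.2.1 ^ 2 - 3 * x.2.2 ^ 2 = 75} ↦
      ∃ v : ℍ[ℚ,((-1 : ℤ) : ℚ),((3 : ℤ) : ℚ)], (v ∈ order (-1) 3 ∨ v - ⟨1/2, 1/2, 1/2, -1/2⟩ ∈ order (-1) 3) ∧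
        ((v * star v).re = 1 ∨ (v * star v).re = -1) ∧
        v * ⟨0, x.1.1, x.1.2.1, x.1.2.2⟩ = ⟨0, y.1.1, y.1.2.1, y.1.2.2⟩ * v)),
        ((Nat.card
          {u : ℍ[ℚ,((-1 : ℤ) : ℚ),((3 : ℤ) : ℚ)] // (u ∈ order (-1) 3 ∨ u - ⟨1/2, 1/2, 1/2, -1/2⟩ ∈ order (-1) 3) ∧
            ((u * star u).re = 1 ∨ (u * star u).re = -1) ∧
            u * ⟨0, q.out.1.1, q.out.1.2.1, q.out.1.2.2⟩ = ⟨0, q.out.1.1, q.out.1.2.1, q.out.1.2.2⟩ * u} : ℚ))⁻¹ = 4 + 2 / 3 := by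
  rw [degree_seventyfive_eq_primitive_add, degree_primitive_seventyfive, degree_primitive_three]

end Values

end Literature.Geometry.Kaehler.ComplexTorus.QuaternionType
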